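import Mathlib
import HarnessLib
import Summits.NavierStokesRegularity.NavierStokesRegularity.Theorems.LocalSineTubeDoorLocalPointZoomHessSlices
import Summits.NavierStokesRegularity.NavierStokesRegularity.Theorems.LocalSineTubeDoorWindowFatouSecondOrder
import Summits.NavierStokesRegularity.NavierStokesRegularity.Theorems.LocalTraceTubeDoorHarmonicHead

/-!
# The one-window door family — the HARMONIC-HEAD («Lamb-divergence») DOOR, PROVED:
# Type-I blow-up needs a non-harmonic Bernoulli head — a Lamb vector with non-zero divergence — on every similarity window

Cell ns-regularity-ideate, seat p6 (route-directed support for nsreg-p1's door family; bears_on LADDER-NS N0; anchor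
`--supports stmt-NavierStokesRegularity-20018`, the profile-rigidity item of the family).  The DOOR for the second-order
scalar `H(u) = ⟪u, Δu⟫ + |curl u|² = Δ(p + |u|²/2) = div(u × ω)` (profile crux = `…LocalTraceTubeDoorHarmonicHead
.harmonicHeadWindowRigidity`), assembled from the family's second-order universal zoom
`…LocalPointZoomHessSlices.localPointZoomVelGradHessSlices` and the second-order window glue
`…WindowFatouSecondOrder.windowFatou_secondOrder` with `F(x, A, B) = ⟪x, Σᵢ B(eᵢ,eᵢ)⟫ + |curl A|²` (continuous; NOT
separately homogeneous in the three slots, but homogeneous of weight `σ⁴ν²` under the COUPLED parabolic scalings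
`(σν, σ²ν, σ³ν)` that the glue produces, which is all that is needed):

**`targetHead`**: a classical Leray–Hopf flow from rapidly decaying data that is locally Type I at `(x₀, T)` and whose
scale-invariant head-Laplacian density `(T−t)²·(⟪u, Δu⟫ + |curl u|²)(t, x₀ + √(T−t)y)` fades in `L¹` on ONE nonempty
open similarity window is backward bounded at `x₀`.

At the profile level this door contains S12 `LocalLambTubeDoor` (Beltrami window `u × ω → 0` ⇒ `div(u × ω) → 0` in
the limit) and S14 is its pressure twin (`Δp` in place of `ΔΠ`).

WHAT THIS IS NOT: not a claim about Navier–Stokes regularity (Clay A) — a local regularity CRITERION conditional on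
local Type I (bears_on LADDER-NS N0, door family); establishment in the cell's sense still requires the cross-family
referee PASS + independent reproduction.
-/

noncomputable section

-- the summit and its single sub-problem share the name (CONVENTIONS §1), as in every Theorems file
set_option linter.dupNamespace false

namespace Summit.NavierStokesRegularity.NavierStokesRegularity.Theorems.LocalTraceTubeDoorHarmonicHeadTarget

open MeasureTheory Set Function Filter Topology TopologicalSpace Metric
open scoped RealInnerProductSpace InnerProductSpace NNReal ENNReal Laplacian
open Literature.Analysis Literature.Analysis.FluidPDE
open Summit.NavierStokesRegularity.NavierStokesRegularity.Theorems.LocalSineTubeDoorLocalPointZoomHessSlices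
open Summit.NavierStokesRegularity.NavierStokesRegularity.Theorems.LocalSineTubeDoorWindowFatouSecondOrder
open Summit.NavierStokesRegularity.NavierStokesRegularity.Theorems.LocalTraceTubeDoorHarmonicHead

/-- The trace of a bilinear map in the standard orthonormal basis of `ℝ³`: `B ↦ Σᵢ B(eᵢ, eᵢ)`. -/
theorem continuous_traceBil :
    Continuous fun B : ContinuousMultilinearMap ℝ (fun _ : Fin 2 => EuclideanSpace ℝ (Fin 3)) (EuclideanSpace ℝ (Fin 3)) =>
      ∑ i, B ![(stdOrthonormalBasis ℝ (EuclideanSpace ℝ (Fin 3))) i,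
        (stdOrthonormalBasis ℝ (EuclideanSpace ℝ (Fin 3))) i] := by
  refine continuous_finsetSum _ fun i _ => ?_
  exact (ContinuousMultilinearMap.apply ℝ (fun _ : Fin 2 => EuclideanSpace ℝ (Fin 3)) (EuclideanSpace ℝ (Fin 3))
    ![(stdOrthonormalBasis ℝ (EuclideanSpace ℝ (Fin 3))) i, (stdOrthonormalBasis ℝ (EuclideanSpace ℝ (Fin 3))) i]).continuous

/-- **The head-source scalar `F(x, A, B) = ⟪x, Σᵢ B(eᵢ,eᵢ)⟫ + |curl A|²` is continuous in `(x, A, B)`.** -/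
theorem continuous_headScalar :
    Continuous fun q : EuclideanSpace ℝ (Fin 3) × (EuclideanSpace ℝ (Fin 3) →L[ℝ] EuclideanSpace ℝ (Fin 3)) ×
      ContinuousMultilinearMap ℝ (fun _ : Fin 2 => EuclideanSpace ℝ (Fin 3)) (EuclideanSpace ℝ (Fin 3)) =>
      (fun (x : EuclideanSpace ℝ (Fin 3)) (A : EuclideanSpace ℝ (Fin 3) →L[ℝ] EuclideanSpace ℝ (Fin 3))
        (B : ContinuousMultilinearMap ℝ (fun _ : Fin 2 => EuclideanSpace ℝ (Fin 3)) (EuclideanSpace ℝ (Fin 3))) =>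
        ⟪x, ∑ i, B ![(stdOrthonormalBasis ℝ (EuclideanSpace ℝ (Fin 3))) i,
          (stdOrthonormalBasis ℝ (EuclideanSpace ℝ (Fin 3))) i]⟫_ℝ + ‖curlCLM A‖ ^ 2) q.1 q.2.1 q.2.2 := by
  have h1 : Continuous fun q : EuclideanSpace ℝ (Fin 3) × (EuclideanSpace ℝ (Fin 3) →L[ℝ] EuclideanSpace ℝ (Fin 3)) ×
      ContinuousMultilinearMap ℝ (fun _ : Fin 2 => EuclideanSpace ℝ (Fin 3)) (EuclideanSpace ℝ (Fin 3)) =>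
      ⟪q.1, ∑ i, q.2.2 ![(stdOrthonormalBasis ℝ (EuclideanSpace ℝ (Fin 3))) i,
        (stdOrthonormalBasis ℝ (EuclideanSpace ℝ (Fin 3))) i]⟫_ℝ :=
    continuous_fst.inner (continuous_traceBil.comp (continuous_snd.comp continuous_snd))
  have h2 : Continuous fun q : EuclideanSpace ℝ (Fin 3) × (EuclideanSpace ℝ (Fin 3) →L[ℝ] EuclideanSpace ℝ (Fin 3)) ×
      ContinuousMultilinearMap ℝ (fun _ : Fin 2 => EuclideanSpace ℝ (Fin 3)) (EuclideanSpace ℝ (Fin 3)) =>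
      ‖curlCLM q.2.1‖ ^ 2 :=
    ((curlCLM.continuous.comp (continuous_fst.comp continuous_snd)).norm).pow 2
  exact h1.add h2

/-- **The trace of the second derivative in the standard basis is the Laplacian.** -/
theorem sum_iteratedFDeriv_two_eq_laplacian (w : EuclideanSpace ℝ (Fin 3) → EuclideanSpace ℝ (Fin 3))
    (x : EuclideanSpace ℝ (Fin 3)) :
    ∑ i, iteratedFDeriv ℝ 2 w x ![(stdOrthonormalBasis ℝ (EuclideanSpace ℝ (Fin 3))) i,
        (stdOrthonormalBasis ℝ (EuclideanSpace ℝ (Fin 3))) i] = (Δ w) x := by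
  rw [InnerProductSpace.laplacian_eq_iteratedFDeriv_stdOrthonormalBasis]

/-- `curlCLM (Dw(x)) = curl w (x)` (definitional). -/
theorem curlCLM_fderiv (w : EuclideanSpace ℝ (Fin 3) → EuclideanSpace ℝ (Fin 3)) (x : EuclideanSpace ℝ (Fin 3)) :
    curlCLM (fderiv ℝ w x) = curl w x := (curl_eq_curlCLM w x).symm

/-- **Coupled parabolic scaling of the head-source scalar**: `F(a x, b A, c B) = a c ⟪x, Σ B(eᵢ,eᵢ)⟫ + b² |curl A|²`. -/
theorem headScalar_smul (a b c : ℝ) (x : EuclideanSpace ℝ (Fin 3))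
    (A : EuclideanSpace ℝ (Fin 3) →L[ℝ] EuclideanSpace ℝ (Fin 3))
    (B : ContinuousMultilinearMap ℝ (fun _ : Fin 2 => EuclideanSpace ℝ (Fin 3)) (EuclideanSpace ℝ (Fin 3))) :
    ⟪a • x, ∑ i, (c • B) ![(stdOrthonormalBasis ℝ (EuclideanSpace ℝ (Fin 3))) i,
        (stdOrthonormalBasis ℝ (EuclideanSpace ℝ (Fin 3))) i]⟫_ℝ + ‖curlCLM (b • A)‖ ^ 2 =
      a * c * ⟪x, ∑ i, B ![(stdOrthonormalBasis ℝ (EuclideanSpace ℝ (Fin 3))) i,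
        (stdOrthonormalBasis ℝ (EuclideanSpace ℝ (Fin 3))) i]⟫_ℝ + b ^ 2 * ‖curlCLM A‖ ^ 2 := by
  have h1 : ∑ i, (c • B) ![(stdOrthonormalBasis ℝ (EuclideanSpace ℝ (Fin 3))) i,
      (stdOrthonormalBasis ℝ (EuclideanSpace ℝ (Fin 3))) i] =
      c • ∑ i, B ![(stdOrthonormalBasis ℝ (EuclideanSpace ℝ (Fin 3))) i,
        (stdOrthonormalBasis ℝ (EuclideanSpace ℝ (Fin 3))) i] := by
    rw [Finset.smul_sum]
    rfl
  rw [h1, real_inner_smul_left, real_inner_smul_right, map_smul, norm_smul, mul_pow, Real.norm_eq_abs, sq_abs]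
  ring

/-- **THE HARMONIC-HEAD DOOR.**  A classical Leray–Hopf flow from rapidly decaying data that is locally Type I at `x₀`
and whose scale-invariant head-Laplacian density `(T−t)²·(⟪u, Δu⟫ + |curl u|²)` — the scale-normalised divergence of the
Lamb vector `u × ω` — fades in `L¹` on ONE similarity window `x₀ + √(T−t)·U` is backward bounded at `x₀`. -/
theorem targetHead :
    ∀ (ν T : ℝ), 0 < ν → 0 < T → ∀ (u : ℝ → EuclideanSpace ℝ (Fin 3) → EuclideanSpace ℝ (Fin 3))
      (p : ℝ → EuclideanSpace ℝ (Fin 3) → ℝ),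
    Literature.Analysis.FluidPDE.IsClassicalNSSolutionOn (Set.Ico 0 T) ν 0 u p →
    Literature.Analysis.FluidPDE.IsLerayHopfOn T ν 0 (u 0) u →
    Literature.Analysis.FluidPDE.HasRapidSpatialDecay (u 0) →
    ∀ (x₀ : EuclideanSpace ℝ (Fin 3)) (ρ M : ℝ), 0 < ρ →
    (∀ t ∈ Set.Ico 0 T, T - ρ ^ 2 < t → ∀ x ∈ Metric.ball x₀ ρ, ‖u t x‖ * Real.sqrt (ν * (T - t)) ≤ M) →
    ∀ (U : Set (EuclideanSpace ℝ (Fin 3))), IsOpen U → U.Nonempty →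
    Filter.Tendsto (fun t => ∫⁻ y in U, ENNReal.ofReal
        |(T - t) ^ 2 * (⟪u t (x₀ + Real.sqrt (T - t) • y), (Δ (u t)) (x₀ + Real.sqrt (T - t) • y)⟫_ℝ +
          ‖Literature.Analysis.FluidPDE.curl (u t) (x₀ + Real.sqrt (T - t) • y)‖ ^ 2)|)
      (nhdsWithin T (Set.Iio T)) (nhds 0) →
    Literature.Analysis.FluidPDE.IsBackwardBoundedAt u T x₀ := by
  intro ν T hν hT u p hcl hLH hdec x₀ ρ M hρ hM U hU hUne hfade
  by_contra hnot
  obtain ⟨C, v, lam, hlam, hlam0, ⟨hrate, hcont, hmild, hdiv⟩, hsing, hconv⟩ :=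
    localPointZoomVelGradHessSlices ν T hν hT u p hcl hLH hdec x₀ ρ M hρ hM hnot
  -- the head-source scalar in `F(x, A, B)` form
  set F : EuclideanSpace ℝ (Fin 3) → (EuclideanSpace ℝ (Fin 3) →L[ℝ] EuclideanSpace ℝ (Fin 3)) →
      ContinuousMultilinearMap ℝ (fun _ : Fin 2 => EuclideanSpace ℝ (Fin 3)) (EuclideanSpace ℝ (Fin 3)) → ℝ :=
    fun x A B => ⟪x, ∑ i, B ![(stdOrthonormalBasis ℝ (EuclideanSpace ℝ (Fin 3))) i,
      (stdOrthonormalBasis ℝ (EuclideanSpace ℝ (Fin 3))) i]⟫_ℝ + ‖curlCLM A‖ ^ 2 with hF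
  have hFc : Continuous fun q : EuclideanSpace ℝ (Fin 3) × (EuclideanSpace ℝ (Fin 3) →L[ℝ] EuclideanSpace ℝ (Fin 3)) ×
      ContinuousMultilinearMap ℝ (fun _ : Fin 2 => EuclideanSpace ℝ (Fin 3)) (EuclideanSpace ℝ (Fin 3)) =>
      F q.1 q.2.1 q.2.2 := continuous_headScalar
  -- the fading hypothesis in `F` form
  have hfade' : Tendsto (fun t => ∫⁻ y in U, ENNReal.ofReal
      |F (Real.sqrt (T - t) • u t (x₀ + Real.sqrt (T - t) • y))
        (Real.sqrt (T - t) ^ 2 • fderiv ℝ (u t) (x₀ + Real.sqrt (T - t) • y))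
        (Real.sqrt (T - t) ^ 3 • iteratedFDeriv ℝ 2 (u t) (x₀ + Real.sqrt (T - t) • y))|) (𝓝[<] T) (𝓝 0) := by
    have hev : ∀ᶠ t in 𝓝[<] T, t < T := eventually_nhdsWithin_of_forall fun t ht => ht
    refine hfade.congr' (hev.mono fun t ht => ?_)
    refine lintegral_congr fun y => ?_
    have hs : 0 ≤ T - t := (sub_pos.2 ht).le
    congr 2
    rw [hF]
    dsimp only
    rw [headScalar_smul, sum_iteratedFDeriv_two_eq_laplacian, curlCLM_fderiv]
    have e1 : Real.sqrt (T - t) * Real.sqrt (T - t) ^ 3 = (T - t) ^ 2 := by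
      rw [← pow_succ', show (3 + 1 : ℕ) = 2 * 2 by norm_num, pow_mul, Real.sq_sqrt hs]
    have e2 : (Real.sqrt (T - t) ^ 2) ^ 2 = (T - t) ^ 2 := by rw [Real.sq_sqrt hs]
    rw [e1, e2]
    ring
  refine harmonicHeadWindowRigidity C v hrate hcont hmild hdiv (fun s hs => ?_) hsing
  have hns : 0 < -s := neg_pos.2 hs
  set σ : ℝ := Real.sqrt (-s) / Real.sqrt ν with hσ
  have hσpos : 0 < σ := div_pos (Real.sqrt_pos.2 hns) (Real.sqrt_pos.2 hν)
  refine ⟨(fun z => σ⁻¹ • z) ⁻¹' U, hU.preimage (continuous_const_smul σ⁻¹), ?_, fun z hz => ?_⟩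
  · obtain ⟨u₀, hu₀⟩ := hUne
    refine ⟨σ • u₀, ?_⟩
    show σ⁻¹ • (σ • u₀) ∈ U
    rwa [smul_smul, inv_mul_cancel₀ hσpos.ne', one_smul]
  · have hz' : σ⁻¹ • z ∈ U := hz
    have h0 := windowFatou_secondOrder hν hT hcl hlam hlam0 hrate hcont hmild hconv F hFc hU hfade' hs hz'
    rw [← hσ, smul_inv_smul₀ hσpos.ne', hF] at h0
    dsimp only at h0
    rw [headScalar_smul, sum_iteratedFDeriv_two_eq_laplacian, curlCLM_fderiv] at h0
    -- `σν · σ³ν = (σ²ν)² > 0`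
    have hpos : 0 < (σ ^ 2 * ν) ^ 2 := by positivity
    have e : σ * ν * (σ ^ 3 * ν) = (σ ^ 2 * ν) ^ 2 := by ring
    rw [e, ← mul_add] at h0
    rcases mul_eq_zero.1 h0 with h | h
    · exact absurd h hpos.ne'
    · exact h

end Summit.NavierStokesRegularity.NavierStokesRegularity.Theorems.LocalTraceTubeDoorHarmonicHeadTarget

end
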